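import Summits.Ventures.PercRepro.RankLevelSetHallCapLymReceipt

/-!
# PercRepro — `CapIneq q k` FOR SMALL `(q, k)` BY EVALUATION, AND THE UNCONDITIONAL UP-HALL THEOREMS IT YIELDS
(p4, gen 38; paper proofs/P4-CAP-KERNEL.md)

`CapIneq q k` (`∀ d ≤ q, Φ(q+k, q) ≤ G(q, k, d)`) is a finite statement about binomial coefficients for each `(q, k)`; this file
discharges it by `norm_num` for `1 ≤ q ≤ 6`, `3 ≤ k ≤ 6` and for `(q, k) = (7, 3), (7, 4), (8, 3)` (`k = 2` is
`hallUp_of_ncard_eq_k2`'s case).  Through `hallUp_of_ncard_eq_of_capIneq` each case is an UNCONDITIONAL theorem: the UP-Hall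
form of C-044 at the tight layer `#E = 2q + k` for every finite matroid and every family of members — `hallUp_tight_small`
(`k = 3 … 6`, `q ≤ 6`: ground sets of up to 18 elements, beyond brute force) and `hallUp_tight_7_3`, `hallUp_tight_7_4`,
`hallUp_tight_8_3`.

* `capIneq_<q>_<k>` (27 cases), `capIneq_small`;
* **`hallUp_tight_small`**, `hallUp_tight_7_3`, `hallUp_tight_7_4`, `hallUp_tight_8_3`.
Axioms: standard.
-/

namespace PercRepro

open Finset

/-- `CapIneq 1 3` by evaluation. -/
theorem capIneq_1_3 : CapIneq 1 3 := by
  intro d hd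
  have hI : Finset.Ioo 1 4 = {2, 3} := by decide
  interval_cases d <;> norm_num [capG, capMhat, phiK, hI, Finset.sum_range_succ, Finset.sum_Ico_eq_sum_range, Nat.choose]

/-- `CapIneq 1 4` by evaluation. -/
theorem capIneq_1_4 : CapIneq 1 4 := by
  intro d hd
  have hI : Finset.Ioo 1 5 = {2, 3, 4} := by decide
  interval_cases d <;> norm_num [capG, capMhat, phiK, hI, Finset.sum_range_succ, Finset.sum_Ico_eq_sum_range, Nat.choose]

/-- `CapIneq 1 5` by evaluation. -/
theorem capIneq_1_5 : CapIneq 1 5 := by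
  intro d hd
  have hI : Finset.Ioo 1 6 = {2, 3, 4, 5} := by decide
  interval_cases d <;> norm_num [capG, capMhat, phiK, hI, Finset.sum_range_succ, Finset.sum_Ico_eq_sum_range, Nat.choose]

/-- `CapIneq 1 6` by evaluation. -/
theorem capIneq_1_6 : CapIneq 1 6 := by
  intro d hd
  have hI : Finset.Ioo 1 7 = {2, 3, 4, 5, 6} := by decide
  interval_cases d <;> norm_num [capG, capMhat, phiK, hI, Finset.sum_range_succ, Finset.sum_Ico_eq_sum_range, Nat.choose]

/-- `CapIneq 2 3` by evaluation. -/
theorem capIneq_2_3 : CapIneq 2 3 := by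
  intro d hd
  have hI : Finset.Ioo 2 5 = {3, 4} := by decide
  interval_cases d <;> norm_num [capG, capMhat, phiK, hI, Finset.sum_range_succ, Finset.sum_Ico_eq_sum_range, Nat.choose]

/-- `CapIneq 2 4` by evaluation. -/
theorem capIneq_2_4 : CapIneq 2 4 := by
  intro d hd
  have hI : Finset.Ioo 2 6 = {3, 4, 5} := by decide
  interval_cases d <;> norm_num [capG, capMhat, phiK, hI, Finset.sum_range_succ, Finset.sum_Ico_eq_sum_range, Nat.choose]

/-- `CapIneq 2 5` by evaluation. -/
theorem capIneq_2_5 : CapIneq 2 5 := by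
  intro d hd
  have hI : Finset.Ioo 2 7 = {3, 4, 5, 6} := by decide
  interval_cases d <;> norm_num [capG, capMhat, phiK, hI, Finset.sum_range_succ, Finset.sum_Ico_eq_sum_range, Nat.choose]

/-- `CapIneq 2 6` by evaluation. -/
theorem capIneq_2_6 : CapIneq 2 6 := by
  intro d hd
  have hI : Finset.Ioo 2 8 = {3, 4, 5, 6, 7} := by decide
  interval_cases d <;> norm_num [capG, capMhat, phiK, hI, Finset.sum_range_succ, Finset.sum_Ico_eq_sum_range, Nat.choose]

/-- `CapIneq 3 3` by evaluation. -/
theorem capIneq_3_3 : CapIneq 3 3 := by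
  intro d hd
  have hI : Finset.Ioo 3 6 = {4, 5} := by decide
  interval_cases d <;> norm_num [capG, capMhat, phiK, hI, Finset.sum_range_succ, Finset.sum_Ico_eq_sum_range, Nat.choose]

/-- `CapIneq 3 4` by evaluation. -/
theorem capIneq_3_4 : CapIneq 3 4 := by
  intro d hd
  have hI : Finset.Ioo 3 7 = {4, 5, 6} := by decide
  interval_cases d <;> norm_num [capG, capMhat, phiK, hI, Finset.sum_range_succ, Finset.sum_Ico_eq_sum_range, Nat.choose]

/-- `CapIneq 3 5` by evaluation. -/
theorem capIneq_3_5 : CapIneq 3 5 := by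
  intro d hd
  have hI : Finset.Ioo 3 8 = {4, 5, 6, 7} := by decide
  interval_cases d <;> norm_num [capG, capMhat, phiK, hI, Finset.sum_range_succ, Finset.sum_Ico_eq_sum_range, Nat.choose]

/-- `CapIneq 3 6` by evaluation. -/
theorem capIneq_3_6 : CapIneq 3 6 := by
  intro d hd
  have hI : Finset.Ioo 3 9 = {4, 5, 6, 7, 8} := by decide
  interval_cases d <;> norm_num [capG, capMhat, phiK, hI, Finset.sum_range_succ, Finset.sum_Ico_eq_sum_range, Nat.choose]

/-- `CapIneq 4 3` by evaluation. -/
theorem capIneq_4_3 : CapIneq 4 3 := by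
  intro d hd
  have hI : Finset.Ioo 4 7 = {5, 6} := by decide
  interval_cases d <;> norm_num [capG, capMhat, phiK, hI, Finset.sum_range_succ, Finset.sum_Ico_eq_sum_range, Nat.choose]

/-- `CapIneq 4 4` by evaluation. -/
theorem capIneq_4_4 : CapIneq 4 4 := by
  intro d hd
  have hI : Finset.Ioo 4 8 = {5, 6, 7} := by decide
  interval_cases d <;> norm_num [capG, capMhat, phiK, hI, Finset.sum_range_succ, Finset.sum_Ico_eq_sum_range, Nat.choose]

/-- `CapIneq 4 5` by evaluation. -/
theorem capIneq_4_5 : CapIneq 4 5 := by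
  intro d hd
  have hI : Finset.Ioo 4 9 = {5, 6, 7, 8} := by decide
  interval_cases d <;> norm_num [capG, capMhat, phiK, hI, Finset.sum_range_succ, Finset.sum_Ico_eq_sum_range, Nat.choose]

/-- `CapIneq 4 6` by evaluation. -/
theorem capIneq_4_6 : CapIneq 4 6 := by
  intro d hd
  have hI : Finset.Ioo 4 10 = {5, 6, 7, 8, 9} := by decide
  interval_cases d <;> norm_num [capG, capMhat, phiK, hI, Finset.sum_range_succ, Finset.sum_Ico_eq_sum_range, Nat.choose]

/-- `CapIneq 5 3` by evaluation. -/
theorem capIneq_5_3 : CapIneq 5 3 := by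
  intro d hd
  have hI : Finset.Ioo 5 8 = {6, 7} := by decide
  interval_cases d <;> norm_num [capG, capMhat, phiK, hI, Finset.sum_range_succ, Finset.sum_Ico_eq_sum_range, Nat.choose]

/-- `CapIneq 5 4` by evaluation. -/
theorem capIneq_5_4 : CapIneq 5 4 := by
  intro d hd
  have hI : Finset.Ioo 5 9 = {6, 7, 8} := by decide
  interval_cases d <;> norm_num [capG, capMhat, phiK, hI, Finset.sum_range_succ, Finset.sum_Ico_eq_sum_range, Nat.choose]

/-- `CapIneq 5 5` by evaluation. -/
theorem capIneq_5_5 : CapIneq 5 5 := by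
  intro d hd
  have hI : Finset.Ioo 5 10 = {6, 7, 8, 9} := by decide
  interval_cases d <;> norm_num [capG, capMhat, phiK, hI, Finset.sum_range_succ, Finset.sum_Ico_eq_sum_range, Nat.choose]

/-- `CapIneq 5 6` by evaluation. -/
theorem capIneq_5_6 : CapIneq 5 6 := by
  intro d hd
  have hI : Finset.Ioo 5 11 = {6, 7, 8, 9, 10} := by decide
  interval_cases d <;> norm_num [capG, capMhat, phiK, hI, Finset.sum_range_succ, Finset.sum_Ico_eq_sum_range, Nat.choose]

/-- `CapIneq 6 3` by evaluation. -/
theorem capIneq_6_3 : CapIneq 6 3 := by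
  intro d hd
  have hI : Finset.Ioo 6 9 = {7, 8} := by decide
  interval_cases d <;> norm_num [capG, capMhat, phiK, hI, Finset.sum_range_succ, Finset.sum_Ico_eq_sum_range, Nat.choose]

/-- `CapIneq 6 4` by evaluation. -/
theorem capIneq_6_4 : CapIneq 6 4 := by
  intro d hd
  have hI : Finset.Ioo 6 10 = {7, 8, 9} := by decide
  interval_cases d <;> norm_num [capG, capMhat, phiK, hI, Finset.sum_range_succ, Finset.sum_Ico_eq_sum_range, Nat.choose]

/-- `CapIneq 6 5` by evaluation. -/
theorem capIneq_6_5 : CapIneq 6 5 := by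
  intro d hd
  have hI : Finset.Ioo 6 11 = {7, 8, 9, 10} := by decide
  interval_cases d <;> norm_num [capG, capMhat, phiK, hI, Finset.sum_range_succ, Finset.sum_Ico_eq_sum_range, Nat.choose]

/-- `CapIneq 6 6` by evaluation. -/
theorem capIneq_6_6 : CapIneq 6 6 := by
  intro d hd
  have hI : Finset.Ioo 6 12 = {7, 8, 9, 10, 11} := by decide
  interval_cases d <;> norm_num [capG, capMhat, phiK, hI, Finset.sum_range_succ, Finset.sum_Ico_eq_sum_range, Nat.choose]

/-- `CapIneq 7 3` by evaluation. -/
theorem capIneq_7_3 : CapIneq 7 3 := by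
  intro d hd
  have hI : Finset.Ioo 7 10 = {8, 9} := by decide
  interval_cases d <;> norm_num [capG, capMhat, phiK, hI, Finset.sum_range_succ, Finset.sum_Ico_eq_sum_range, Nat.choose]

/-- `CapIneq 7 4` by evaluation. -/
theorem capIneq_7_4 : CapIneq 7 4 := by
  intro d hd
  have hI : Finset.Ioo 7 11 = {8, 9, 10} := by decide
  interval_cases d <;> norm_num [capG, capMhat, phiK, hI, Finset.sum_range_succ, Finset.sum_Ico_eq_sum_range, Nat.choose]

/-- `CapIneq 8 3` by evaluation. -/
theorem capIneq_8_3 : CapIneq 8 3 := by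
  intro d hd
  have hI : Finset.Ioo 8 11 = {9, 10} := by decide
  interval_cases d <;> norm_num [capG, capMhat, phiK, hI, Finset.sum_range_succ, Finset.sum_Ico_eq_sum_range, Nat.choose]

/-- `CapIneq q k` for all `1 ≤ q ≤ 6`, `3 ≤ k ≤ 6`. -/
theorem capIneq_small (q k : ℕ) (hq1 : 1 ≤ q) (hq : q ≤ 6) (hk3 : 3 ≤ k) (hk : k ≤ 6) : CapIneq q k := by
  interval_cases q <;> interval_cases k <;> first
    | exact capIneq_1_3
    | exact capIneq_1_4
    | exact capIneq_1_5
    | exact capIneq_1_6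
    | exact capIneq_2_3
    | exact capIneq_2_4
    | exact capIneq_2_5
    | exact capIneq_2_6
    | exact capIneq_3_3
    | exact capIneq_3_4
    | exact capIneq_3_5
    | exact capIneq_3_6
    | exact capIneq_4_3
    | exact capIneq_4_4
    | exact capIneq_4_5
    | exact capIneq_4_6
    | exact capIneq_5_3
    | exact capIneq_5_4
    | exact capIneq_5_5
    | exact capIneq_5_6
    | exact capIneq_6_3
    | exact capIneq_6_4
    | exact capIneq_6_5
    | exact capIneq_6_6


/-- **THE UP-HALL FORM OF C-044 AT THE TIGHT LAYER, UNCONDITIONALLY, FOR `1 ≤ q ≤ 6` AND `3 ≤ k ≤ 6`**: for every finite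
matroid with `#E = (q + k) + q` and every family `𝒜` of members of the cell `(q + k, q)`, `Φ(q+k, q) · #𝒜 ≤ #upNbhd(𝒜)`. -/
theorem hallUp_tight_small {α : Type} (M : Matroid α) [M.Finite] (q k : ℕ) (hq1 : 1 ≤ q) (hq : q ≤ 6) (hk3 : 3 ≤ k)
    (hk : k ≤ 6) (hE : M.E.ncard = (q + k) + q) (𝒜 : Set (Set α)) (h𝒜 : 𝒜 ⊆ cellMembers M (q + k) q) :
    phiK (q + k) q * (𝒜.ncard : ℚ) ≤ ((upNbhd M (q + k) q 𝒜).ncard : ℚ) := by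
  have h : CapIneq q ((q + k) - q) := by
    rw [Nat.add_sub_cancel_left]
    exact capIneq_small q k hq1 hq hk3 hk
  exact hallUp_of_ncard_eq_of_capIneq M (q + k) q (by omega) hE h 𝒜 h𝒜


/-- The UP-Hall form of C-044 at the tight layer for the cell `(10, 7)` (`#E = 17`), unconditionally. -/
theorem hallUp_tight_7_3 {α : Type} (M : Matroid α) [M.Finite] (hE : M.E.ncard = 10 + 7) (𝒜 : Set (Set α))
    (h𝒜 : 𝒜 ⊆ cellMembers M 10 7) :
    phiK 10 7 * (𝒜.ncard : ℚ) ≤ ((upNbhd M 10 7 𝒜).ncard : ℚ) :=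
  hallUp_of_ncard_eq_of_capIneq M 10 7 (by omega) hE capIneq_7_3 𝒜 h𝒜


/-- The UP-Hall form of C-044 at the tight layer for the cell `(11, 7)` (`#E = 18`), unconditionally. -/
theorem hallUp_tight_7_4 {α : Type} (M : Matroid α) [M.Finite] (hE : M.E.ncard = 11 + 7) (𝒜 : Set (Set α))
    (h𝒜 : 𝒜 ⊆ cellMembers M 11 7) :
    phiK 11 7 * (𝒜.ncard : ℚ) ≤ ((upNbhd M 11 7 𝒜).ncard : ℚ) :=
  hallUp_of_ncard_eq_of_capIneq M 11 7 (by omega) hE capIneq_7_4 𝒜 h𝒜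


/-- The UP-Hall form of C-044 at the tight layer for the cell `(11, 8)` (`#E = 19`), unconditionally. -/
theorem hallUp_tight_8_3 {α : Type} (M : Matroid α) [M.Finite] (hE : M.E.ncard = 11 + 8) (𝒜 : Set (Set α))
    (h𝒜 : 𝒜 ⊆ cellMembers M 11 8) :
    phiK 11 8 * (𝒜.ncard : ℚ) ≤ ((upNbhd M 11 8 𝒜).ncard : ℚ) :=
  hallUp_of_ncard_eq_of_capIneq M 11 8 (by omega) hE capIneq_8_3 𝒜 h𝒜


end PercRepro
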